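/-
Copyright (c) 2026 the pub-hodgecm-mathlib formalisation cell (harness21).  Prover seat hodgecm-mathlib-LD1-p02 (g4), FLOOR 0, programme P6,
half-A line LD1 of crux `hLiu418`, brick (Gα-C∞) `ArchLadder`, plate (P4) «ι-step», sub-brick (P4c) assembly.  KERNEL module: THEOREMS ONLY
(no definition, no named fact, no `sorry`, no instance, no notation).
-/
import Literature.NumberTheory.GelbartRogawski1991.DoubledWeilRepresentationArchPlaceBoost
import Literature.NumberTheory.GelbartRogawski1991.DoubledWeilRepresentationArchPlaceBoxOperators
import Literature.NumberTheory.GelbartRogawski1991.DoubledWeilRepresentationArchPlaceBoxLevi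
import Literature.NumberTheory.Weil1964.ArchJunctionBoostEntries
import HarnessLib

/-!
# Folland's section at the one-place BOOST, read on the Hermite box vectors of the doubled frame: the box identity
# `frameD^* sectionD(k_{v₀,u}) (frameD^*)⁻¹ (R_{e₂}(h^V_{β₁} ⊠ h^V_{β₂})) = c • R_{e₂}((frameV^* B_t (frameV^*)⁻¹ h^V_{β₁}) ⊠ h^V_{β₂})`
# ([Folland1989, §4.2 (4.24), Prop. (4.39)]; [KonnoKonno2007, §3.1, §3.3]; [HarrisKudlaSweet1996, §1 (1.9)])

Topic `NumberTheory/GelbartRogawski1991`; namespace `Literature.NumberTheory.GelbartRogawski1991.GRConstruction`.  KERNEL ONLY: proved theorems;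
0 definitions, 0 records, 0 `sorry`.  Continuation of ★ `DoubledWeilRepresentationArchPlaceBoost` (§3 there: `sectionD (k_{v₀,u}) = c • e_* ∘ hypOp t ∘ e_*⁻¹` for a
boost `u`), ★ `JunctionHyperbolicReindex` (`e_* ∘ hypOp t ∘ e_*⁻¹ = μ₀((u^ε)⁻¹) ∘ leviS(δ^ε) ∘ μ₀(u^ε)`), ★ β-II on a general first slot
(`DoubledWeilRepresentationArchPlaceBoxOperators`, A-p13 (g40)), ★ the first-copy Levi box lemma (`DoubledWeilRepresentationArchPlaceBoxLevi`, A-p13 (g40)) and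
★ `ArchJunctionBoostEntries` (entries ∕ `archIdx` bookkeeping).

* §1 the THREE IDENTIFICATIONS of the doubled datum at `v₀`: the relabelled Siegel frame of the doubled junction IS the place-block unitary
  `placeBlock (δ_{v₀} ↦ (W ⊕ 1)^{e₂})` of β-II with `W ∈ U(n)` the relabelled Siegel frame of the plane `{k₊, k₋} ⊂ Fin n`
  (`reindexUnitary_archIdx_frameU_doubled`), the one of the PAIR junction IS `placeBlock (δ_{v₀} ↦ W)` (`reindexUnitary_archIdx_frameU_pair`), and the
  relabelled plane dilation of the doubled junction IS the first-copy dilation of the Levi box lemma (`reindexLin_archIdx_planeDil_doubled`);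
* §2 **`carrierConjEquiv_frameD_sectionD_archKPlace_of_boost`** — THE BOX IDENTITY (the `hS` of ★ T2 `pairRep_chiSplittingLine_adelicSingle_tmul_of_box`): at a
  boost `u` of the plane `{k₊, k₋}` (`x_{v₀}(k₊) > 0`, `¬ x_{v₀}(k₋) > 0`; scaled-frame hypothesis `hu`), Folland's section acts on `R_{e₂}(h^V_{β₁} ⊠ h^V_{β₂})`
  through the FIRST box factor by the transported hyperbolic family `B_t = reindexEquiv archIdx_V (hypOpEquiv t)` of the pair junction, times the
  explicit unimodular `c` of ★ `sectionD_archKPlace_apply_of_boost`.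

HONEST SCOPE.  Statements about the tree's own Weil-representation terms; nothing of [Liu2021] is asserted; HC_CM is NOT proved here or anywhere
in the tree.

References: [Folland1989] §1.3 (1.25), §1.7 (1.81), §4.2 (4.24), Prop. (4.39); [KonnoKonno2007] §3.1 (3.1), §3.3; [HarrisKudlaSweet1996] §1 (1.9);
[Kudla1994] §2.
-/

set_option autoImplicit false

noncomputable section

open scoped Matrix Kronecker
open Complex

/-! ## §1 The three identifications of the doubled datum at `v₀` -/

namespace Literature.NumberTheory.GelbartRogawski1991.GRConstruction

open scoped Classical
open NumberField NumberField.InfinitePlace NumberField.mixedEmbedding IsDedekindDomain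
open Literature.NumberTheory.Automorphic Literature.NumberTheory.Automorphic.UnitaryGroup
open Literature.NumberTheory.Weil1964
open UnitaryDualPair
open Literature.NumberTheory.GelbartRogawski1991.UnitaryDualPair.LocalSplitting
open Literature.RepresentationTheory.KonnoKonno2007 Literature.RepresentationTheory.KonnoKonno2007.RealDualPair
open Literature.Analysis.SegalBargmann Literature.RepresentationTheory.HeisenbergGroup
open Literature.NumberTheory.Weil1964.MpS Literature.NumberTheory.Weil1964.UnitaryWeil

variable (L : Type) [Field L] [NumberField L] [IsCMField L]

variable {N M n : ℕ} (e : Fin N × Fin M ≃ Fin n)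
  (dV : Fin N → L) (hdV : ∀ i, IsCMField.complexConj L (dV i) = dV i)
  (dW : Fin M → L) (hdW : ∀ i, IsCMField.complexConj L (dW i) = dW i)
  (v₀ : {v : InfinitePlace (Fp L) // v.IsReal})

/-- **THE RELABELLED SIEGEL FRAME OF THE DOUBLED JUNCTION IS THE PLACE-BLOCK UNITARY OF β-II**: along `archIdx` of the doubled datum, the Siegel frame of the
plane `(⟨v₀, e₂(inl k₊)⟩, ⟨v₀, e₂(inl k₋)⟩)` is `placeBlock (δ_{v₀} ↦ (W ⊕ 1)^{e₂})` with `W ∈ U(n)` the Siegel frame of the plane `{k₊, k₋}` read along the sign-split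
junction presentation of `Fin n` at `v₀` (entrywise: ★ `ArchJunctionBoostEntries`). [cite: Folland1989, §4.2 Prop. (4.39)] [cite: HarrisKudlaSweet1996, §1 (1.9)] [cite: KonnoKonno2007, §3.3] -/
theorem reindexUnitary_archIdx_frameU_doubled (kp km : Fin n)
    (hp : 0 < signVec (cmPlaceOver L) (cmGramEntry L e dV hdV dW hdW) (imagUnit L) v₀ kp)
    (hm : ¬0 < signVec (cmPlaceOver L) (cmGramEntry L e dV hdV dW hdW) (imagUnit L) v₀ km)
    (Hp : 0 < signVec (cmPlaceOver L) (entryD L e dV hdV dW hdW) (imagUnit L) v₀ ((e₂ (n := n)) (Sum.inl kp)))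
    (Hm : ¬0 < signVec (cmPlaceOver L) (entryD L e dV hdV dW hdW) (imagUnit L) v₀ ((e₂ (n := n)) (Sum.inl km))) :
    -- (`(_)` for the instance arguments of the doubled junction: they are ASSIGNED from the tree's `frameU` term, never re-synthesised)
    @reindexUnitary _ _ _ _ (_) (_) (archIdx L (n + n) (cmPlaceOver L) (entryD L e dV hdV dW hdW) (δ := imagUnit L))
        (frameU Unit Empty
          (⟨v₀, ⟨(e₂ (n := n)) (Sum.inl kp), Hp⟩⟩ : Σ v, PosIdx (signVec (cmPlaceOver L) (entryD L e dV hdV dW hdW) (imagUnit L) v))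
          (⟨v₀, ⟨(e₂ (n := n)) (Sum.inl km), Hm⟩⟩ : Σ v, NegIdx (signVec (cmPlaceOver L) (entryD L e dV hdV dW hdW) (imagUnit L) v))) =
      placeBlock (Pi.mulSingle v₀ (reindexUnitary (e₂ (n := n)).symm (blockU
        (reindexUnitary ((signSplit (signVec (cmPlaceOver L) (cmGramEntry L e dV hdV dW hdW) (imagUnit L) v₀)).trans (unitJunctionIdx _ _))
          (frameU Unit Empty (⟨kp, hp⟩ : PosIdx (signVec (cmPlaceOver L) (cmGramEntry L e dV hdV dW hdW) (imagUnit L) v₀))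
            (⟨km, hm⟩ : NegIdx (signVec (cmPlaceOver L) (cmGramEntry L e dV hdV dW hdW) (imagUnit L) v₀))), 1)))) := by
  -- the conditions of ★ `reindexUnitary_frameU_apply`, read through ★ `archIdx_eq_idxP_iff`
  have HP : ∀ (j : Fin (n + n)) (v : {v : InfinitePlace (Fp L) // v.IsReal}),
      (archIdx L (n + n) (cmPlaceOver L) (entryD L e dV hdV dW hdW) (δ := imagUnit L) (j, v) =
        idxP Unit Empty (⟨v₀, ⟨(e₂ (n := n)) (Sum.inl kp), Hp⟩⟩ :
          Σ v, PosIdx (signVec (cmPlaceOver L) (entryD L e dV hdV dW hdW) (imagUnit L) v)) ()) = (v = v₀ ∧ j = (e₂ (n := n)) (Sum.inl kp)) :=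
    fun j v => propext (archIdx_eq_idxP_iff L (n + n) (cmPlaceOver L) (entryD L e dV hdV dW hdW) j v v₀ _ Hp)
  have HQ : ∀ (j : Fin (n + n)) (v : {v : InfinitePlace (Fp L) // v.IsReal}),
      (archIdx L (n + n) (cmPlaceOver L) (entryD L e dV hdV dW hdW) (δ := imagUnit L) (j, v) =
        idxQ Unit Empty (⟨v₀, ⟨(e₂ (n := n)) (Sum.inl km), Hm⟩⟩ :
          Σ v, NegIdx (signVec (cmPlaceOver L) (entryD L e dV hdV dW hdW) (imagUnit L) v)) ()) = (v = v₀ ∧ j = (e₂ (n := n)) (Sum.inl km)) :=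
    fun j v => propext (archIdx_eq_idxQ_iff L (n + n) (cmPlaceOver L) (entryD L e dV hdV dW hdW) j v v₀ _ Hm)
  have HE : ∀ (z z' : Fin (n + n) × {v : InfinitePlace (Fp L) // v.IsReal}),
      (archIdx L (n + n) (cmPlaceOver L) (entryD L e dV hdV dW hdW) (δ := imagUnit L) z' =
        archIdx L (n + n) (cmPlaceOver L) (entryD L e dV hdV dW hdW) (δ := imagUnit L) z) = (z' = z) :=
    fun z z' => propext (Equiv.apply_eq_iff_eq _)
  have H1P : ∀ i : Fin n,
      (((signSplit (signVec (cmPlaceOver L) (cmGramEntry L e dV hdV dW hdW) (imagUnit L) v₀)).trans (unitJunctionIdx _ _)) i =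
        idxP Unit Empty (⟨kp, hp⟩ : PosIdx (signVec (cmPlaceOver L) (cmGramEntry L e dV hdV dW hdW) (imagUnit L) v₀)) ()) = (i = kp) :=
    fun i => propext (signSplit_trans_unitJunctionIdx_eq_idxP_iff n _ i kp hp)
  have H1Q : ∀ i : Fin n,
      (((signSplit (signVec (cmPlaceOver L) (cmGramEntry L e dV hdV dW hdW) (imagUnit L) v₀)).trans (unitJunctionIdx _ _)) i =
        idxQ Unit Empty (⟨km, hm⟩ : NegIdx (signVec (cmPlaceOver L) (cmGramEntry L e dV hdV dW hdW) (imagUnit L) v₀)) ()) = (i = km) :=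
    fun i => propext (signSplit_trans_unitJunctionIdx_eq_idxQ_iff n _ i km hm)
  have H1E : ∀ i i' : Fin n,
      (((signSplit (signVec (cmPlaceOver L) (cmGramEntry L e dV hdV dW hdW) (imagUnit L) v₀)).trans (unitJunctionIdx _ _)) i' =
        ((signSplit (signVec (cmPlaceOver L) (cmGramEntry L e dV hdV dW hdW) (imagUnit L) v₀)).trans (unitJunctionIdx _ _)) i) = (i' = i) :=
    fun i i' => propext (Equiv.apply_eq_iff_eq _)
  have hinj : ∀ a b : Fin n ⊕ Fin n, ((e₂ (n := n)) a = (e₂ (n := n)) b) = (a = b) := fun a b => propext (e₂ (n := n)).injective.eq_iff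
  have hkpm : kp ≠ km := fun h => hm (h ▸ hp)
  apply Subtype.ext
  ext ⟨j, v⟩ ⟨j', v'⟩
  rw [reindexUnitary_frameU_apply, coe_placeBlock_mulSingle, Matrix.blockDiagonal_apply]
  simp only [HP, HQ, HE]
  by_cases hvv : v = v'
  · subst hvv
    rw [if_pos rfl, Pi.mulSingle_apply]
    by_cases hv : v = v₀
    · subst hv
      rw [if_pos rfl, reindexUnitary_apply, coe_blockU]
      obtain ⟨z, rfl⟩ := (e₂ (n := n)).surjective j
      obtain ⟨z', rfl⟩ := (e₂ (n := n)).surjective j'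
      simp only [Equiv.symm_apply_apply, true_and, Prod.mk.injEq, and_true, hinj]
      rcases z with i | i <;> rcases z' with i' | i'
      · rw [Matrix.fromBlocks_apply₁₁, reindexUnitary_frameU_apply]
        simp only [H1P, H1Q, H1E, Sum.inl.injEq]
      · rw [Matrix.fromBlocks_apply₁₂, Matrix.zero_apply]
        simp only [reduceCtorEq, if_false, mul_zero, sub_zero, add_zero, ite_self]
      · rw [Matrix.fromBlocks_apply₂₁, Matrix.zero_apply]
        simp only [reduceCtorEq, if_false]
      · rw [Matrix.fromBlocks_apply₂₂, OneMemClass.coe_one, Matrix.one_apply]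
        simp only [reduceCtorEq, if_false, Sum.inr.injEq]
        simp only [eq_comm]
    · rw [if_neg hv, Matrix.one_apply]
      simp only [hv, false_and, if_false, Prod.mk.injEq, and_true]
      simp only [eq_comm]
  · rw [if_neg hvv]
    have h1 : ¬(v' = v₀ ∧ j' = (e₂ (n := n)) (Sum.inl kp)) ∨ True := Or.inr trivial
    by_cases hv : v = v₀
    · subst hv
      have hv' : ¬v' = v := fun h => hvv h.symm
      simp only [hv', false_and, if_false, mul_zero, sub_zero, add_zero, ite_self, Prod.mk.injEq, and_false]
    · simp only [hv, false_and, if_false, Prod.mk.injEq]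
      rw [if_neg (fun h => hvv h.2.symm)]

/-- **THE RELABELLED SIEGEL FRAME OF THE PAIR JUNCTION IS `placeBlock (δ_{v₀} ↦ W)`**: along `archIdx` of the (undoubled) pair datum, the Siegel frame of the
plane `(⟨v₀, k₊⟩, ⟨v₀, k₋⟩)` is the place-block unitary of the same `W ∈ U(n)` (entrywise: ★ `ArchJunctionBoostEntries`). [cite: Folland1989, §4.2 Prop. (4.39)] [cite: KonnoKonno2007, §3.3] -/
theorem reindexUnitary_archIdx_frameU_pair (kp km : Fin n)
    (hp : 0 < signVec (cmPlaceOver L) (cmGramEntry L e dV hdV dW hdW) (imagUnit L) v₀ kp)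
    (hm : ¬0 < signVec (cmPlaceOver L) (cmGramEntry L e dV hdV dW hdW) (imagUnit L) v₀ km) :
    @reindexUnitary _ _ _ _ (_) (_) (archIdx L n (cmPlaceOver L) (cmGramEntry L e dV hdV dW hdW) (δ := imagUnit L))
        (frameU Unit Empty
          (⟨v₀, ⟨kp, hp⟩⟩ : Σ v, PosIdx (signVec (cmPlaceOver L) (cmGramEntry L e dV hdV dW hdW) (imagUnit L) v))
          (⟨v₀, ⟨km, hm⟩⟩ : Σ v, NegIdx (signVec (cmPlaceOver L) (cmGramEntry L e dV hdV dW hdW) (imagUnit L) v))) =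
      placeBlock (Pi.mulSingle v₀
        (reindexUnitary ((signSplit (signVec (cmPlaceOver L) (cmGramEntry L e dV hdV dW hdW) (imagUnit L) v₀)).trans (unitJunctionIdx _ _))
          (frameU Unit Empty (⟨kp, hp⟩ : PosIdx (signVec (cmPlaceOver L) (cmGramEntry L e dV hdV dW hdW) (imagUnit L) v₀))
            (⟨km, hm⟩ : NegIdx (signVec (cmPlaceOver L) (cmGramEntry L e dV hdV dW hdW) (imagUnit L) v₀))))) := by
  have HP : ∀ (j : Fin n) (v : {v : InfinitePlace (Fp L) // v.IsReal}),
      (archIdx L n (cmPlaceOver L) (cmGramEntry L e dV hdV dW hdW) (δ := imagUnit L) (j, v) =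
        idxP Unit Empty (⟨v₀, ⟨kp, hp⟩⟩ : Σ v, PosIdx (signVec (cmPlaceOver L) (cmGramEntry L e dV hdV dW hdW) (imagUnit L) v)) ()) =
        (v = v₀ ∧ j = kp) :=
    fun j v => propext (archIdx_eq_idxP_iff L n (cmPlaceOver L) (cmGramEntry L e dV hdV dW hdW) j v v₀ _ hp)
  have HQ : ∀ (j : Fin n) (v : {v : InfinitePlace (Fp L) // v.IsReal}),
      (archIdx L n (cmPlaceOver L) (cmGramEntry L e dV hdV dW hdW) (δ := imagUnit L) (j, v) =
        idxQ Unit Empty (⟨v₀, ⟨km, hm⟩⟩ : Σ v, NegIdx (signVec (cmPlaceOver L) (cmGramEntry L e dV hdV dW hdW) (imagUnit L) v)) ()) =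
        (v = v₀ ∧ j = km) :=
    fun j v => propext (archIdx_eq_idxQ_iff L n (cmPlaceOver L) (cmGramEntry L e dV hdV dW hdW) j v v₀ _ hm)
  have HE : ∀ (z z' : Fin n × {v : InfinitePlace (Fp L) // v.IsReal}),
      (archIdx L n (cmPlaceOver L) (cmGramEntry L e dV hdV dW hdW) (δ := imagUnit L) z' =
        archIdx L n (cmPlaceOver L) (cmGramEntry L e dV hdV dW hdW) (δ := imagUnit L) z) = (z' = z) :=
    fun z z' => propext (Equiv.apply_eq_iff_eq _)
  have H1P : ∀ i : Fin n,
      (((signSplit (signVec (cmPlaceOver L) (cmGramEntry L e dV hdV dW hdW) (imagUnit L) v₀)).trans (unitJunctionIdx _ _)) i =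
        idxP Unit Empty (⟨kp, hp⟩ : PosIdx (signVec (cmPlaceOver L) (cmGramEntry L e dV hdV dW hdW) (imagUnit L) v₀)) ()) = (i = kp) :=
    fun i => propext (signSplit_trans_unitJunctionIdx_eq_idxP_iff n _ i kp hp)
  have H1Q : ∀ i : Fin n,
      (((signSplit (signVec (cmPlaceOver L) (cmGramEntry L e dV hdV dW hdW) (imagUnit L) v₀)).trans (unitJunctionIdx _ _)) i =
        idxQ Unit Empty (⟨km, hm⟩ : NegIdx (signVec (cmPlaceOver L) (cmGramEntry L e dV hdV dW hdW) (imagUnit L) v₀)) ()) = (i = km) :=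
    fun i => propext (signSplit_trans_unitJunctionIdx_eq_idxQ_iff n _ i km hm)
  have H1E : ∀ i i' : Fin n,
      (((signSplit (signVec (cmPlaceOver L) (cmGramEntry L e dV hdV dW hdW) (imagUnit L) v₀)).trans (unitJunctionIdx _ _)) i' =
        ((signSplit (signVec (cmPlaceOver L) (cmGramEntry L e dV hdV dW hdW) (imagUnit L) v₀)).trans (unitJunctionIdx _ _)) i) = (i' = i) :=
    fun i i' => propext (Equiv.apply_eq_iff_eq _)
  apply Subtype.ext
  ext ⟨j, v⟩ ⟨j', v'⟩
  rw [reindexUnitary_frameU_apply, coe_placeBlock_mulSingle, Matrix.blockDiagonal_apply]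
  simp only [HP, HQ, HE]
  by_cases hvv : v = v'
  · subst hvv
    rw [if_pos rfl, Pi.mulSingle_apply]
    by_cases hv : v = v₀
    · subst hv
      rw [if_pos rfl, reindexUnitary_frameU_apply]
      simp only [H1P, H1Q, H1E, true_and, Prod.mk.injEq, and_true]
    · rw [if_neg hv, Matrix.one_apply]
      simp only [hv, false_and, if_false, Prod.mk.injEq, and_true]
      simp only [eq_comm]
  · rw [if_neg hvv]
    by_cases hv : v = v₀
    · subst hv
      have hv' : ¬v' = v := fun h => hvv h.symm
      simp only [hv', false_and, if_false, mul_zero, sub_zero, add_zero, ite_self, Prod.mk.injEq, and_false]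
    · simp only [hv, false_and, if_false, Prod.mk.injEq]
      rw [if_neg (fun h => hvv h.2.symm)]

/-- **THE RELABELLED PLANE DILATION OF THE DOUBLED JUNCTION IS A FIRST-COPY DILATION**: along `archIdx` of the doubled datum, the plane dilation `δ_c` of the plane
`(⟨v₀, e₂(inl k₊)⟩, ⟨v₀, e₂(inl k₋)⟩)` is the diagonal dilation with the weights `dilWt c ∘ archIdx` of the PAIR junction on the first copy and `1` on the second
— the shape of ★ `leviS_diagEquiv_doubled_schwartzTransport_frameD`. [cite: Folland1989, §4.2 (4.24)] [cite: HarrisKudlaSweet1996, §1 (1.9)] -/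
theorem reindexLin_archIdx_planeDil_doubled (kp km : Fin n)
    (hp : 0 < signVec (cmPlaceOver L) (cmGramEntry L e dV hdV dW hdW) (imagUnit L) v₀ kp)
    (hm : ¬0 < signVec (cmPlaceOver L) (cmGramEntry L e dV hdV dW hdW) (imagUnit L) v₀ km)
    (Hp : 0 < signVec (cmPlaceOver L) (entryD L e dV hdV dW hdW) (imagUnit L) v₀ ((e₂ (n := n)) (Sum.inl kp)))
    (Hm : ¬0 < signVec (cmPlaceOver L) (entryD L e dV hdV dW hdW) (imagUnit L) v₀ ((e₂ (n := n)) (Sum.inl km))) (c : ℝ) (hc : c ≠ 0) :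
    reindexLin (archIdx L (n + n) (cmPlaceOver L) (entryD L e dV hdV dW hdW) (δ := imagUnit L))
        (planeDil Unit Empty
          (⟨v₀, ⟨(e₂ (n := n)) (Sum.inl kp), Hp⟩⟩ : Σ v, PosIdx (signVec (cmPlaceOver L) (entryD L e dV hdV dW hdW) (imagUnit L) v))
          (⟨v₀, ⟨(e₂ (n := n)) (Sum.inl km), Hm⟩⟩ : Σ v, NegIdx (signVec (cmPlaceOver L) (entryD L e dV hdV dW hdW) (imagUnit L) v)) c hc) =
      RealDualPair.diagEquiv
        (fun k : Fin (n + n) × {v : InfinitePlace (Fp L) // v.IsReal} =>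
          Sum.elim (fun i : Fin n => (dilWt Unit Empty
              (⟨v₀, ⟨kp, hp⟩⟩ : Σ v, PosIdx (signVec (cmPlaceOver L) (cmGramEntry L e dV hdV dW hdW) (imagUnit L) v))
              (⟨v₀, ⟨km, hm⟩⟩ : Σ v, NegIdx (signVec (cmPlaceOver L) (cmGramEntry L e dV hdV dW hdW) (imagUnit L) v)) c ∘
            (archIdx L n (cmPlaceOver L) (cmGramEntry L e dV hdV dW hdW) (δ := imagUnit L))) (i, k.2)) (fun _ : Fin n => (1 : ℝ))
            ((e₂ (n := n)).symm k.1))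
        (doubledWeight_ne_zero L _ (fun _ => dilWt_ne_zero Unit Empty _ _ hc _)) := by
  rw [reindexLin_planeDil]
  refine LinearEquiv.ext fun x => funext fun k => ?_
  rw [RealDualPair.diagEquiv_apply, RealDualPair.diagEquiv_apply]
  congr 1
  obtain ⟨j, v⟩ := k
  obtain ⟨z, rfl⟩ := (e₂ (n := n)).surjective j
  rw [Function.comp_apply, dilWt_apply_equiv, Equiv.symm_apply_apply]
  have hP : ((e₂ (n := n)) z, v) = (archIdx L (n + n) (cmPlaceOver L) (entryD L e dV hdV dW hdW) (δ := imagUnit L)).symm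
        (idxP Unit Empty (⟨v₀, ⟨(e₂ (n := n)) (Sum.inl kp), Hp⟩⟩ :
          Σ v, PosIdx (signVec (cmPlaceOver L) (entryD L e dV hdV dW hdW) (imagUnit L) v)) ()) ↔ v = v₀ ∧ z = Sum.inl kp := by
    rw [Equiv.eq_symm_apply, archIdx_eq_idxP_iff, (e₂ (n := n)).injective.eq_iff]
  have hQ : ((e₂ (n := n)) z, v) = (archIdx L (n + n) (cmPlaceOver L) (entryD L e dV hdV dW hdW) (δ := imagUnit L)).symm
        (idxQ Unit Empty (⟨v₀, ⟨(e₂ (n := n)) (Sum.inl km), Hm⟩⟩ :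
          Σ v, NegIdx (signVec (cmPlaceOver L) (entryD L e dV hdV dW hdW) (imagUnit L) v)) ()) ↔ v = v₀ ∧ z = Sum.inl km := by
    rw [Equiv.eq_symm_apply, archIdx_eq_idxQ_iff, (e₂ (n := n)).injective.eq_iff]
  rcases z with i | i
  · rw [Sum.elim_inl, Function.comp_apply, dilWt_apply_equiv]
    have hP' : (i, v) = (archIdx L n (cmPlaceOver L) (cmGramEntry L e dV hdV dW hdW) (δ := imagUnit L)).symm
          (idxP Unit Empty (⟨v₀, ⟨kp, hp⟩⟩ : Σ v, PosIdx (signVec (cmPlaceOver L) (cmGramEntry L e dV hdV dW hdW) (imagUnit L) v)) ()) ↔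
          v = v₀ ∧ i = kp := by
      rw [Equiv.eq_symm_apply, archIdx_eq_idxP_iff]
    have hQ' : (i, v) = (archIdx L n (cmPlaceOver L) (cmGramEntry L e dV hdV dW hdW) (δ := imagUnit L)).symm
          (idxQ Unit Empty (⟨v₀, ⟨km, hm⟩⟩ : Σ v, NegIdx (signVec (cmPlaceOver L) (cmGramEntry L e dV hdV dW hdW) (imagUnit L) v)) ()) ↔
          v = v₀ ∧ i = km := by
      rw [Equiv.eq_symm_apply, archIdx_eq_idxQ_iff]
    simp only [hP, hQ, hP', hQ', Sum.inl.injEq]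
  · rw [Sum.elim_inr]
    simp only [hP, hQ, reduceCtorEq, and_false, or_self, if_false]

/-! ## §2 THE BOX IDENTITY at the one-place boost -/

variable (hdV0 : ∀ i, dV i ≠ 0) (hdW0 : ∀ i, dW i ≠ 0)

/-- inverse of a one-place block unitary. [cite: Folland1989, §4.2 Prop. (4.39)] -/
theorem placeBlock_mulSingle_inv {ι o : Type} [Fintype ι] [DecidableEq ι] [Fintype o] [DecidableEq o] (v : o) (X : Matrix.unitaryGroup ι ℂ) :
    (placeBlock (Pi.mulSingle v X))⁻¹ = placeBlock (Pi.mulSingle v X⁻¹) := by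
  rw [placeBlock_inv]
  congr 1
  funext w
  rw [Pi.mulSingle_inv, Pi.inv_apply]

include hdV0 hdW0 in
set_option maxHeartbeats 2000000 in
-- (instance unification along the two junction relabellings; the rewrites are few)
/-- **THE BOX IDENTITY AT `k_{v₀,u}` FOR A BOOST `u` OF THE PLANE `{k₊, k₋}`** (the `hS` of ★ T2 `pairRep_chiSplittingLine_adelicSingle_tmul_of_box`):
`frameD^* sectionD(k_{v₀,u}) (frameD^*)⁻¹ (R_{e₂}(h^V_{β₁} ⊠ h^V_{β₂})) = c • R_{e₂}((frameV^* B_t (frameV^*)⁻¹ h^V_{β₁}) ⊠ h^V_{β₂})`, where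
`B_t = reindexEquiv archIdx_V (hypOpEquiv t)` is the hyperbolic family of the PAIR junction transported to `𝓢(ℝ^{Fin n × places})` (plane `(⟨v₀,k₊⟩, ⟨v₀,k₋⟩)`) and
`c = C(weilHomV a_t) ∕ C(hypOp t)` the unimodular scalar of ★ `sectionD_archKPlace_apply_of_boost` — Folland's section at the boost acts on the Hermite box vectors through
the FIRST box factor.  (§1 + ★ `schwartzTransport_reindexCLE_hypOp_symm` + ★ β-II general first slot + ★ the first-copy Levi box lemma.)
[cite: Folland1989, §4.2 (4.24), Prop. (4.39)] [cite: HarrisKudlaSweet1996, §1 (1.9)] [cite: KonnoKonno2007, §3.3] -/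
theorem carrierConjEquiv_frameD_sectionD_archKPlace_of_boost (u : UnitaryGroup.archLocal L N (Matrix.diagonal dV) (cmPlaceOver L v₀)) (t : ℝ)
    (kp km : Fin n)
    (hp : 0 < signVec (cmPlaceOver L) (cmGramEntry L e dV hdV dW hdW) (imagUnit L) v₀ kp)
    (hm : ¬0 < signVec (cmPlaceOver L) (cmGramEntry L e dV hdV dW hdW) (imagUnit L) v₀ km)
    (Hp : 0 < signVec (cmPlaceOver L) (entryD L e dV hdV dW hdW) (imagUnit L) v₀ ((e₂ (n := n)) (Sum.inl kp)))
    (Hm : ¬0 < signVec (cmPlaceOver L) (entryD L e dV hdV dW hdW) (imagUnit L) v₀ ((e₂ (n := n)) (Sum.inl km)))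
    (hu : ∀ i i' : Fin n,
      ((sqrtAbs (signVec (cmPlaceOver L) (cmGramEntry L e dV hdV dW hdW) (imagUnit L) v₀) i : ℝ) : ℂ) *
          Matrix.reindex e e
            ((((u : UnitaryGroup.archLocal L N (Matrix.diagonal dV) (cmPlaceOver L v₀)) : GL (Fin N) ℂ) : Matrix (Fin N) (Fin N) ℂ) ⊗ₖ
              (1 : Matrix (Fin M) (Fin M) ℂ)) i i' *
          (((sqrtAbs (signVec (cmPlaceOver L) (cmGramEntry L e dV hdV dW hdW) (imagUnit L) v₀) i' : ℝ) : ℂ))⁻¹ =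
        if i = kp then (if i' = kp then (Real.cosh t : ℂ) else if i' = km then -(Real.sinh t : ℂ) * I else 0)
        else if i = km then (if i' = kp then (Real.sinh t : ℂ) * I else if i' = km then (Real.cosh t : ℂ) else 0)
        else if i = i' then 1 else 0)
    (β₁ β₂ : (Fin n × {v : InfinitePlace (Fp L) // v.IsReal}) →₀ ℕ) :
    carrierConjEquiv (frameD L e dV hdV hdV0 dW hdW hdW0) (sectionD L e dV hdV hdV0 dW hdW hdW0 (archKPlace L e dV hdV dW hdW v₀ u)).1.2
        (schwartzReindexCLM (Fp L) (e₂ (n := n))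
          (archBoxTensor (follandHermite (frameV L e dV hdV hdV0 dW hdW hdW0) β₁) (follandHermite (frameV L e dV hdV hdV0 dW hdW hdW0) β₂))) =
      (vac (weilHomV (Σ v, PosIdx (signVec (cmPlaceOver L) (entryD L e dV hdV dW hdW) (imagUnit L) v))
              (Σ v, NegIdx (signVec (cmPlaceOver L) (entryD L e dV hdV dW hdW) (imagUnit L) v)) Unit Empty
              (hypV ⟨v₀, ⟨(e₂ (n := n)) (Sum.inl kp), Hp⟩⟩ ⟨v₀, ⟨(e₂ (n := n)) (Sum.inl km), Hm⟩⟩ t)) /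
          vacCoeffS (hypOp Unit Empty
            (⟨v₀, ⟨(e₂ (n := n)) (Sum.inl kp), Hp⟩⟩ : Σ v, PosIdx (signVec (cmPlaceOver L) (entryD L e dV hdV dW hdW) (imagUnit L) v))
            (⟨v₀, ⟨(e₂ (n := n)) (Sum.inl km), Hm⟩⟩ : Σ v, NegIdx (signVec (cmPlaceOver L) (entryD L e dV hdV dW hdW) (imagUnit L) v)) t)) •
        schwartzReindexCLM (Fp L) (e₂ (n := n))
          (archBoxTensor
            (carrierConjEquiv (frameV L e dV hdV hdV0 dW hdW hdW0)
              (MpS.reindexEquiv (archIdx L n (cmPlaceOver L) (cmGramEntry L e dV hdV dW hdW) (δ := imagUnit L))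
                (hypOpEquiv Unit Empty
                  (⟨v₀, ⟨kp, hp⟩⟩ : Σ v, PosIdx (signVec (cmPlaceOver L) (cmGramEntry L e dV hdV dW hdW) (imagUnit L) v))
                  (⟨v₀, ⟨km, hm⟩⟩ : Σ v, NegIdx (signVec (cmPlaceOver L) (cmGramEntry L e dV hdV dW hdW) (imagUnit L) v)) t))
              (follandHermite (frameV L e dV hdV hdV0 dW hdW hdW0) β₁))
            (follandHermite (frameV L e dV hdV hdV0 dW hdW hdW0) β₂)) := by
  -- the transported doubled hyperbolic family, factor by factor, in β-II ∕ Levi-box shape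
  have hop : ∀ g : SchwartzMap ((Fin (n + n) × {v : InfinitePlace (Fp L) // v.IsReal}) → ℝ) ℂ,
      schwartzTransport (reindexCLE (archIdx L (n + n) (cmPlaceOver L) (entryD L e dV hdV dW hdW) (δ := imagUnit L)))
          (hypOp Unit Empty
            (⟨v₀, ⟨(e₂ (n := n)) (Sum.inl kp), Hp⟩⟩ : Σ v, PosIdx (signVec (cmPlaceOver L) (entryD L e dV hdV dW hdW) (imagUnit L) v))
            (⟨v₀, ⟨(e₂ (n := n)) (Sum.inl km), Hm⟩⟩ : Σ v, NegIdx (signVec (cmPlaceOver L) (entryD L e dV hdV dW hdW) (imagUnit L) v)) t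
            ((schwartzTransport (reindexCLE (archIdx L (n + n) (cmPlaceOver L) (entryD L e dV hdV dW hdW) (δ := imagUnit L)))).symm g)) =
        unitaryOpPi (placeBlock (Pi.mulSingle v₀ (reindexUnitary (e₂ (n := n)).symm (blockU
          ((reindexUnitary ((signSplit (signVec (cmPlaceOver L) (cmGramEntry L e dV hdV dW hdW) (imagUnit L) v₀)).trans (unitJunctionIdx _ _))
            (frameU Unit Empty (⟨kp, hp⟩ : PosIdx (signVec (cmPlaceOver L) (cmGramEntry L e dV hdV dW hdW) (imagUnit L) v₀))
              (⟨km, hm⟩ : NegIdx (signVec (cmPlaceOver L) (cmGramEntry L e dV hdV dW hdW) (imagUnit L) v₀))))⁻¹, 1)))))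
          (leviS (RealDualPair.diagEquiv
            (fun k : Fin (n + n) × {v : InfinitePlace (Fp L) // v.IsReal} =>
              Sum.elim (fun i : Fin n => (dilWt Unit Empty
                  (⟨v₀, ⟨kp, hp⟩⟩ : Σ v, PosIdx (signVec (cmPlaceOver L) (cmGramEntry L e dV hdV dW hdW) (imagUnit L) v))
                  (⟨v₀, ⟨km, hm⟩⟩ : Σ v, NegIdx (signVec (cmPlaceOver L) (cmGramEntry L e dV hdV dW hdW) (imagUnit L) v)) (Real.exp t) ∘
                (archIdx L n (cmPlaceOver L) (cmGramEntry L e dV hdV dW hdW) (δ := imagUnit L))) (i, k.2)) (fun _ : Fin n => (1 : ℝ))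
                ((e₂ (n := n)).symm k.1))
            (doubledWeight_ne_zero L _ (fun _ => dilWt_ne_zero Unit Empty _ _ (Real.exp_pos t).ne' _)))
            (unitaryOpPi (placeBlock (Pi.mulSingle v₀ (reindexUnitary (e₂ (n := n)).symm (blockU
              (reindexUnitary ((signSplit (signVec (cmPlaceOver L) (cmGramEntry L e dV hdV dW hdW) (imagUnit L) v₀)).trans (unitJunctionIdx _ _))
                (frameU Unit Empty (⟨kp, hp⟩ : PosIdx (signVec (cmPlaceOver L) (cmGramEntry L e dV hdV dW hdW) (imagUnit L) v₀))
                  (⟨km, hm⟩ : NegIdx (signVec (cmPlaceOver L) (cmGramEntry L e dV hdV dW hdW) (imagUnit L) v₀))), 1))))) g)) := by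
    intro g
    rw [schwartzTransport_reindexCLE_hypOp_symm]
    rw [reindexUnitary_archIdx_frameU_doubled L e dV hdV dW hdW v₀ kp km hp hm Hp Hm]
    rw [placeBlock_mulSingle_inv, ← map_inv, ← map_inv, Prod.inv_mk, inv_one]
    rw [reindexLin_archIdx_planeDil_doubled L e dV hdV dW hdW v₀ kp km hp hm Hp Hm]
  -- the transported PAIR hyperbolic family, in the same shape
  have hopV : ∀ g : SchwartzMap ((Fin n × {v : InfinitePlace (Fp L) // v.IsReal}) → ℝ) ℂ,
      schwartzTransport (reindexCLE (archIdx L n (cmPlaceOver L) (cmGramEntry L e dV hdV dW hdW) (δ := imagUnit L)))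
          (hypOp Unit Empty
            (⟨v₀, ⟨kp, hp⟩⟩ : Σ v, PosIdx (signVec (cmPlaceOver L) (cmGramEntry L e dV hdV dW hdW) (imagUnit L) v))
            (⟨v₀, ⟨km, hm⟩⟩ : Σ v, NegIdx (signVec (cmPlaceOver L) (cmGramEntry L e dV hdV dW hdW) (imagUnit L) v)) t
            ((schwartzTransport (reindexCLE (archIdx L n (cmPlaceOver L) (cmGramEntry L e dV hdV dW hdW) (δ := imagUnit L)))).symm g)) =
        unitaryOpPi (placeBlock (Pi.mulSingle v₀
          (reindexUnitary ((signSplit (signVec (cmPlaceOver L) (cmGramEntry L e dV hdV dW hdW) (imagUnit L) v₀)).trans (unitJunctionIdx _ _))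
            (frameU Unit Empty (⟨kp, hp⟩ : PosIdx (signVec (cmPlaceOver L) (cmGramEntry L e dV hdV dW hdW) (imagUnit L) v₀))
              (⟨km, hm⟩ : NegIdx (signVec (cmPlaceOver L) (cmGramEntry L e dV hdV dW hdW) (imagUnit L) v₀))))⁻¹))
          (leviS (RealDualPair.diagEquiv
            (dilWt Unit Empty
                  (⟨v₀, ⟨kp, hp⟩⟩ : Σ v, PosIdx (signVec (cmPlaceOver L) (cmGramEntry L e dV hdV dW hdW) (imagUnit L) v))
                  (⟨v₀, ⟨km, hm⟩⟩ : Σ v, NegIdx (signVec (cmPlaceOver L) (cmGramEntry L e dV hdV dW hdW) (imagUnit L) v)) (Real.exp t) ∘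
                (archIdx L n (cmPlaceOver L) (cmGramEntry L e dV hdV dW hdW) (δ := imagUnit L)))
            (fun _ => dilWt_ne_zero Unit Empty _ _ (Real.exp_pos t).ne' _))
            (unitaryOpPi (placeBlock (Pi.mulSingle v₀
              (reindexUnitary ((signSplit (signVec (cmPlaceOver L) (cmGramEntry L e dV hdV dW hdW) (imagUnit L) v₀)).trans (unitJunctionIdx _ _))
                (frameU Unit Empty (⟨kp, hp⟩ : PosIdx (signVec (cmPlaceOver L) (cmGramEntry L e dV hdV dW hdW) (imagUnit L) v₀))
                  (⟨km, hm⟩ : NegIdx (signVec (cmPlaceOver L) (cmGramEntry L e dV hdV dW hdW) (imagUnit L) v₀)))))) g)) := by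
    intro g
    rw [schwartzTransport_reindexCLE_hypOp_symm]
    rw [reindexUnitary_archIdx_frameU_pair L e dV hdV dW hdW v₀ kp km hp hm]
    rw [placeBlock_mulSingle_inv, reindexLin_planeDil]
  -- assemble (`simp only`: reducible matching keeps the many `DFunLike.coe` subterms of the goal cheap to reject)
  rw [carrierConjEquiv_apply, carrierConjEquiv_apply]
  rw [sectionD_archKPlace_apply_of_boost L e dV hdV hdV0 dW hdW hdW0 v₀ u t kp km Hp Hm hu]
  rw [hop]
  simp only [unitaryOpPi_placeBlock_mulSingle_doubled_schwartzTransport_frameD]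
  have hL := leviS_diagEquiv_doubled_schwartzTransport_frameD L e dV hdV hdV0 dW hdW hdW0
    (dilWt Unit Empty
        (⟨v₀, ⟨kp, hp⟩⟩ : Σ v, PosIdx (signVec (cmPlaceOver L) (cmGramEntry L e dV hdV dW hdW) (imagUnit L) v))
        (⟨v₀, ⟨km, hm⟩⟩ : Σ v, NegIdx (signVec (cmPlaceOver L) (cmGramEntry L e dV hdV dW hdW) (imagUnit L) v)) (Real.exp t) ∘
      (archIdx L n (cmPlaceOver L) (cmGramEntry L e dV hdV dW hdW) (δ := imagUnit L)))
    (fun _ => dilWt_ne_zero Unit Empty _ _ (Real.exp_pos t).ne' _)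
    ((schwartzTransport (frameV L e dV hdV hdV0 dW hdW hdW0)).symm
      (unitaryOpPi (placeBlock (Pi.mulSingle v₀
        (reindexUnitary ((signSplit (signVec (cmPlaceOver L) (cmGramEntry L e dV hdV dW hdW) (imagUnit L) v₀)).trans (unitJunctionIdx _ _))
          (frameU Unit Empty (⟨kp, hp⟩ : PosIdx (signVec (cmPlaceOver L) (cmGramEntry L e dV hdV dW hdW) (imagUnit L) v₀))
            (⟨km, hm⟩ : NegIdx (signVec (cmPlaceOver L) (cmGramEntry L e dV hdV dW hdW) (imagUnit L) v₀)))))) (hermitePi β₁)))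
    (follandHermite (frameV L e dV hdV hdV0 dW hdW hdW0) β₂)
  simp only [hL]
  simp only [ContinuousLinearEquiv.apply_symm_apply, unitaryOpPi_placeBlock_mulSingle_doubled_schwartzTransport_frameD_general, map_smul,
    ContinuousLinearEquiv.symm_apply_apply, schwartzTransport_follandHermite, MpS.reindexEquiv_apply, hypOpEquiv_apply, hopV]

end Literature.NumberTheory.GelbartRogawski1991.GRConstruction

end
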